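import Literature.AlgebraicGeometry.Frobenioids.ArchimedeanFSMFFPiecesN
import Literature.AlgebraicGeometry.Frobenioids.ArchimedeanSlitMorphisms
import HarnessLib

/-!
# Frobenioids II, Proposition 3.4 (viii), condition (a) for `F = R`: the MODEL LEMMAS of the
# rigidified angloid `R = R₀ ×_{D₀} D` consumed by the abstract assembly
# (abc-iut cell, layer L1, sub-node `FrdII:Prop3.4(viii)/P34-L14`, pieces M1–M5 for the tower `towerR`)

Mochizuki, *The geometry of Frobenioids II: poly-Frobenioids*, Kyushu J. Math. **62** (2008)
401–460, §3, Proposition 3.4 (viii), proof p. 33 ll. 16–44 [cite: MochizukiFrdII2008, Prop 3.4 (viii) p.33].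

PROOF-ONLY file (nothing is defined): the `R`-analogues of `ArchimedeanFSMFFPiecesA.lean` /
`ArchimedeanFSMFFPiecesN.lean` (same seat), for the tower `towerR π` (`F = R π = R₀ ×_{D₀} D`, a §0
categorical fibre product on the nose; `F₀ = R₀ = (N₀)_A`, the slice over the real unit), with the class
`P α := "the C₀-arrow underlying the R₀-component of α is a pull-back morphism of C₀"`
(`PreFrobenioid.IsPullbackMorphism C0.toElem (R0.toC0.map α.fst)`). A generic fibre-product lemma
(`CFP.exists_lift_fst_fac`: factorisations of the first component whose first member maps to an
isomorphism lift, re-using the second component of the domain) gives (LiftF₀) directly; (Fac) and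
(LiftD) follow t6's `R.propVI` (the linear isometric lifts in `N₀` read over the real unit through the
structure arrow of the codomain) with the pulled-back region recorded; `R0.isPullbackMorphism_of_hom`
lifts the cartesian property from `N₀` to the slice. No side is taken on [IUTchIII] Cor. 3.12.
-/

namespace Literature.AlgebraicGeometry.Frobenioids

open CategoryTheory Set
open scoped Pointwise

noncomputable section

/-! ### A generic lifting lemma for categorical fibre products -/

namespace CFP

universe v₁ v₂ v₃ u₁ u₂ u₃

variable {C₁ : Type u₁} [Category.{v₁} C₁] {C₂ : Type u₂} [Category.{v₂} C₂] {E : Type u₃}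
  [Category.{v₃} E] {Φ₁ : C₁ ⥤ E} {Φ₂ : C₂ ⥤ E}

/-- In `C₁ ×_E C₂`, a factorisation `ε ≫ χ` of the FIRST component of an arrow `β`, whose first member
`ε` maps to an isomorphism of `E`, lifts to a factorisation `β = β₁ ≫ β₂` with `β₁ = (ε, 𝟙)` and
`β₂ = (χ, β₂')` — the middle object re-uses the second component of the domain.
[cite: MochizukiFrdI2008, §0 p.17] -/
theorem exists_lift_fst_fac {X Z : CFP Φ₁ Φ₂} (β : X ⟶ Z) {W₁ : C₁} (ε : X.fst ⟶ W₁)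
    (χ : W₁ ⟶ Z.fst) (hfac : ε ≫ χ = β.fst) (hε : IsIso (Φ₁.map ε)) :
    ∃ (W : CFP Φ₁ Φ₂) (β₁ : X ⟶ W) (β₂ : W ⟶ Z) (i : W.fst ≅ W₁),
      β₁ ≫ β₂ = β ∧ IsIso β₁.snd ∧ β₁.fst ≫ i.hom = ε ∧ i.inv ≫ β₂.fst = χ := by
  haveI := hε
  let ιW : Φ₁.obj W₁ ≅ Φ₂.obj X.snd := (asIso (Φ₁.map ε)).symm ≪≫ X.iso
  have w₁ : Φ₁.map ε ≫ ιW.hom = X.iso.hom ≫ Φ₂.map (𝟙 X.snd) := by simp [ιW]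
  have w₂ : Φ₁.map χ ≫ Z.iso.hom = ιW.hom ≫ Φ₂.map β.snd := by
    simp only [ιW, Iso.trans_hom, Iso.symm_hom, asIso_inv, Category.assoc]
    rw [← β.w, ← hfac, Functor.map_comp, Category.assoc, IsIso.inv_hom_id_assoc]
  refine ⟨⟨W₁, X.snd, ιW⟩, ⟨ε, 𝟙 _, w₁⟩, ⟨χ, β.snd, w₂⟩, Iso.refl _,
    hom_ext hfac (Category.id_comp _), ?_, Category.comp_id _, Category.id_comp _⟩
  change IsIso (𝟙 X.snd)
  infer_instance

end CFP

namespace ArchFrd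

universe v u

/-! ### `R₀`: pull-back morphisms and isomorphisms -/

namespace R0

/-- An arrow of `R₀ = (N₀)_A` whose underlying arrow of `C₀` is a pull-back morphism of `C₀` is a
pull-back morphism of `R₀` (for `R₀ → C₀ → F_{Φ₀}`): the cartesian lift in `N₀`
(`N0.isPullbackMorphism_of_hom`) is automatically a morphism over the real unit.
[cite: MochizukiFrdII2008, Ex 3.3 (iv) p.29] -/
theorem isPullbackMorphism_of_hom {U V : R0} (α : U ⟶ V)
    (hα : PreFrobenioid.IsPullbackMorphism C0.toElem (R0.toC0.map α)) :
    PreFrobenioid.IsPullbackMorphism (R0.toC0 ⋙ C0.toElem) α := by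
  have hN : PreFrobenioid.IsPullbackMorphism (N0.toC0 ⋙ C0.toElem) α.left :=
    N0.isPullbackMorphism_of_hom α.left hα
  intro W
  constructor
  · intro γ γ' hγ
    apply Over.OverMorphism.ext
    apply (hN W.left).1
    apply Subtype.ext
    have h1 := congrArg (fun p : PreFrobenioid.PullbackHomData (R0.toC0 ⋙ C0.toElem) α W => p.1.1) hγ
    have h2 := congrArg (fun p : PreFrobenioid.PullbackHomData (R0.toC0 ⋙ C0.toElem) α W => p.1.2) hγ
    exact Prod.ext (congrArg (fun k : W ⟶ V => k.left) h1) h2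
  · rintro ⟨⟨γ', g⟩, hw⟩
    obtain ⟨γN, hγN⟩ := (hN W.left).2 ⟨(γ'.left, g), hw⟩
    have h1 : γN ≫ α.left = γ'.left :=
      congrArg (fun p : PreFrobenioid.PullbackHomData (N0.toC0 ⋙ C0.toElem) α.left W.left => p.1.1) hγN
    have h2 : C0.Base (N0.homCarrier γN) = g :=
      congrArg (fun p : PreFrobenioid.PullbackHomData (N0.toC0 ⋙ C0.toElem) α.left W.left => p.1.2) hγN
    have hwγ : γN ≫ U.hom = W.hom := by
      rw [← Over.w α, ← Category.assoc, h1]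
      exact Over.w γ'
    refine ⟨Over.homMk γN hwγ, Subtype.ext (Prod.ext ?_ h2)⟩
    exact Over.OverMorphism.ext h1

/-- An arrow of `R₀` whose underlying arrow of `C₀` is invertible is invertible in `R₀` (its
`N₀`-component is invertible, `N0.isIso_of_isIso_carrier`, and a morphism of a slice category with
invertible underlying arrow is invertible). [cite: MochizukiFrdII2008, Ex 3.3 (iv) p.29] -/
theorem isIso_of_isIso_carrier {U V : R0} (α : U ⟶ V) [h : IsIso (R0.toC0.map α)] : IsIso α := by
  haveI : IsIso (N0.homCarrier α.left) := h
  haveI : IsIso α.left := N0.isIso_of_isIso_carrier α.left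
  have : (Over.isoMk (asIso α.left) (Over.w α)).hom = α := Over.OverMorphism.ext rfl
  rw [← this]
  infer_instance

end R0

/-! ### The tower `towerR`: formal pieces -/

variable {D : Type u} [Category.{v} D] (π : D ⥤ D0)

/-- Components of composites in `R` (`D`-components). [cite: MochizukiFrdII2008, Ex 3.3 (iv) p.29] -/
theorem R.comp_snd' {X Y Z : (towerR π).F} (g : X ⟶ Y) (f : Y ⟶ Z) : (g ≫ f).snd = g.snd ≫ f.snd := rfl

/-- Components of composites in `R` (`R₀`-components). [cite: MochizukiFrdII2008, Ex 3.3 (iv) p.29] -/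
theorem R.comp_fst' {X Y Z : (towerR π).F} (g : X ⟶ Y) (f : Y ⟶ Z) : (g ≫ f).fst = g.fst ≫ f.fst := rfl

/-- (Mono) for `R`: an arrow over an isomorphism of `D` whose projection to `R₀` is a monomorphism is a
monomorphism (both components of the fibre-product arrow are monomorphisms).
[cite: MochizukiFrdII2008, Prop 3.4 (viii) p.33] -/
theorem R.mono_of_isIso_snd_of_mono_toR0 {X Y : (towerR π).F} (f : X ⟶ Y)
    (hD : IsIso ((towerR π).toD.map f)) (h0 : Mono ((towerR π).toF0.map f)) : Mono f := by
  haveI : IsIso f.snd := hD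
  haveI : Mono f.fst := h0
  exact CFP.mono_of_mono_fst_snd f

/-- (PMono) for `R`: an arrow whose underlying `C₀`-arrow is a pull-back morphism of `C₀` and whose
`D`-component is a monomorphism is a monomorphism (cartesian uniqueness in `C₀`; the bases agree by the
compatibility square of the fibre product). [cite: MochizukiFrdII2008, Prop 3.4 (viii) p.33] -/
theorem R.mono_of_isPullbackMorphism_fst {Z Y : (towerR π).F} (α : Z ⟶ Y)
    (hP : PreFrobenioid.IsPullbackMorphism C0.toElem (R0.toC0.map α.fst))
    (hD : Mono ((towerR π).toD.map α)) : Mono α := by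
  haveI : Mono α.snd := hD
  refine ⟨fun g h hgh => ?_⟩
  have hs : g.snd = h.snd :=
    (cancel_mono α.snd).mp (by rw [← R.comp_snd', ← R.comp_snd', hgh])
  refine CFP.hom_ext ?_ hs
  have hb : C0.Base (R0.toC0.map g.fst) = C0.Base (R0.toC0.map h.fst) :=
    CFP.map_fst_eq_of_snd_eq g h hs
  apply Over.OverMorphism.ext
  apply N0.hom_ext
  apply (hP _).1
  apply Subtype.ext
  refine Prod.ext ?_ hb
  change R0.toC0.map g.fst ≫ R0.toC0.map α.fst = R0.toC0.map h.fst ≫ R0.toC0.map α.fst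
  rw [← Functor.map_comp, ← Functor.map_comp, ← R.comp_fst', ← R.comp_fst', hgh]

/-- (PIso) for `R`: an arrow whose underlying `C₀`-arrow is a pull-back morphism of `C₀` and whose
`D`-component is an isomorphism is an isomorphism. [cite: MochizukiFrdII2008, Prop 3.4 (viii) p.33] -/
theorem R.isIso_of_isPullbackMorphism_fst_of_isIso_snd {Z Y : (towerR π).F} (α : Z ⟶ Y)
    (hP : PreFrobenioid.IsPullbackMorphism C0.toElem (R0.toC0.map α.fst))
    (hD : IsIso ((towerR π).toD.map α)) : IsIso α := by
  haveI : IsIso α.snd := hD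
  have hw := α.w
  haveI : IsIso (R0.toD0.map α.fst ≫ Y.iso.hom) := by rw [hw]; infer_instance
  have hbi : PreFrobenioid.IsBaseIso C0.toElem (R0.toC0.map α.fst) :=
    IsIso.of_isIso_comp_right (R0.toD0.map α.fst) Y.iso.hom
  haveI : IsIso (R0.toC0.map α.fst) :=
    (PreFrobenioid.isPullbackMorphism_and_isBaseIso_iff_isIso C0.toElem _).1 ⟨hP, hbi⟩
  haveI : IsIso α.fst := R0.isIso_of_isIso_carrier α.fst
  exact CFP.isIso_of_isIso_fst_snd α

/-- (vii) for `R` in the shape of the assembly: from the typed item (vii) of `towerR`.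
[cite: MochizukiFrdII2008, Prop 3.4 (vii) p.30] -/
theorem R.isFSMI_of_isPullbackMorphism_fst_of_propVII (hVII : (towerR π).PropVII)
    {Z Y : (towerR π).F} (α : Z ⟶ Y)
    (hP : PreFrobenioid.IsPullbackMorphism C0.toElem (R0.toC0.map α.fst))
    (hD : IsFSMI ((towerR π).toD.map α)) : IsFSMI α :=
  (hVII α (R0.isPullbackMorphism_of_hom α.fst hP)).2 hD

/-- (LiftF₀) for `R`: a factorisation `ε ≫ χ` in `R₀` of the `R₀`-component of an arrow `β` of `R`,
with `ε` over an isomorphism of `D₀`, lifts to `β = β₁ ≫ β₂` in `R` with `β₁ = (ε, 𝟙)` (the generic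
fibre-product lemma `CFP.exists_lift_fst_fac`). [cite: MochizukiFrdII2008, Prop 3.4 (viii) p.33] -/
theorem R.exists_lift_toR0_fac {X Z : (towerR π).F} (β : X ⟶ Z)
    {W₀ : (towerR π).F0} (ε : (towerR π).toF0.obj X ⟶ W₀) (χ : W₀ ⟶ (towerR π).toF0.obj Z)
    (hfac : ε ≫ χ = (towerR π).toF0.map β)
    (hε : PreFrobenioid.IsBaseIso C0.toElem (R0.toC0.map ε)) :
    ∃ (W : (towerR π).F) (β₁ : X ⟶ W) (β₂ : W ⟶ Z) (i : (towerR π).toF0.obj W ≅ W₀),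
      β₁ ≫ β₂ = β ∧ IsIso ((towerR π).toD.map β₁) ∧ (towerR π).toF0.map β₁ ≫ i.hom = ε ∧
        i.inv ≫ (towerR π).toF0.map β₂ = χ := by
  exact CFP.exists_lift_fst_fac β ε χ hfac hε

/-! ### The tower `towerR`: (Fac) and (LiftD) -/

/-- (Fac) for `R`: every arrow `φ` of `R` factors as `φ = β ≫ α` with `β = (β₀, 𝟙)` over an identity
of `D` and `α` with pull-back underlying `C₀`-arrow `(Base φ₀, 1, 1)` out of the object carrying the
pulled-back region, read over the real unit through the structure arrow of the codomain.
[cite: MochizukiFrdII2008, Prop 3.4 (viii) p.33] -/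
theorem R.exists_fac_pullback {X Y : (towerR π).F} (φ : X ⟶ Y) :
    ∃ (Z : (towerR π).F) (β : X ⟶ Z) (α : Z ⟶ Y), β ≫ α = φ ∧ IsIso ((towerR π).toD.map β) ∧
      PreFrobenioid.IsPullbackMorphism C0.toElem (R0.toC0.map α.fst) := by
  obtain ⟨rX, XD, ιX⟩ := X
  obtain ⟨rY, YD, ιY⟩ := Y
  obtain ⟨g, fD, w⟩ := φ
  change rX ⟶ rY at g
  change XD ⟶ YD at fD
  have hgl : C0.degFr g.left.hom.hom = 1 := g.left.property
  have hgi : C0.div g.left.hom.hom = 1 := g.left.hom.property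
  obtain ⟨Ap, hA, b0, a0, hcomp, hbβ, hbα, hdβ, -, hdivβ, hdα, hsα, hisoα, hcar⟩ :=
    C0.exists_factor_pullRegion g.left.hom.hom (𝟙 _) (C0.Base g.left.hom.hom) (Category.id_comp _)
  have hpb : PreFrobenioid.IsPullbackMorphism C0.toElem a0 :=
    C0.isPullbackMorphism_of_region_eq a0 hdα hsα (by rw [hbα]; exact hcar)
  let nM : N0 := ⟨⟨C0.mk _ Ap hA⟩⟩
  have hisoβ : PreFrobenioid.IsIsometry C0.toElem b0 := by
    change C0.div b0 = 1
    rw [hdivβ, hgi]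
  let gβ : rX.left ⟶ nM := N0.homMk b0 hisoβ (hdβ.trans hgl)
  let gα : nM ⟶ rY.left := N0.homMk a0 hisoα hdα
  have hβα : gβ ≫ gα = g.left := N0.hom_ext hcomp
  let rM : R0 := Over.mk (gα ≫ rY.hom)
  let αO : rM ⟶ rY := Over.homMk gα rfl
  have hwβ : gβ ≫ rM.hom = rX.hom := by
    show gβ ≫ (gα ≫ rY.hom) = rX.hom
    rw [← Category.assoc, hβα]
    exact Over.w g
  let βO : rX ⟶ rM := Over.homMk gβ hwβ
  have hβαO : βO ≫ αO = g := Over.OverMorphism.ext hβα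
  let Z : (towerR π).F := ⟨rM, XD, ιX⟩
  have wβ : R0.toD0.map βO ≫ ιX.hom = ιX.hom ≫ π.map (𝟙 XD) := by
    change C0.Base b0 ≫ ιX.hom = ιX.hom ≫ π.map (𝟙 XD)
    rw [hbβ, CategoryTheory.Functor.map_id, Category.id_comp, Category.comp_id]
  have wα : R0.toD0.map αO ≫ ιY.hom = ιX.hom ≫ π.map fD := by
    change C0.Base a0 ≫ ιY.hom = ιX.hom ≫ π.map fD
    rw [hbα]
    exact w
  refine ⟨Z, ⟨βO, 𝟙 XD, wβ⟩, ⟨αO, fD, wα⟩, CFP.hom_ext hβαO (Category.id_comp _), ?_, hpb⟩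
  change IsIso (𝟙 XD)
  infer_instance

/-- (LiftD) for `R` — item (vi) refined: if the underlying `C₀`-arrow of `α : Z → Y` is a pull-back
morphism of `C₀` and `α_D = δ ≫ χ` in `D`, then `α = α₁ ≫ α₂` in `R` with `α₁`, `α₂` lifting `δ`, `χ`
and with pull-back underlying `C₀`-arrows (t6's construction of `R.propVI`, through the object
carrying the pulled-back region). [cite: MochizukiFrdII2008, Prop 3.4 (vi) p.30] -/
theorem R.exists_factor_pullback {Z Y : (towerR π).F} (α : Z ⟶ Y)
    (hP : PreFrobenioid.IsPullbackMorphism C0.toElem (R0.toC0.map α.fst))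
    {E : D} (δ : (towerR π).toD.obj Z ⟶ E) (χ : E ⟶ (towerR π).toD.obj Y)
    (hfac : δ ≫ χ = (towerR π).toD.map α) :
    ∃ (Z' : (towerR π).F) (α₁ : Z ⟶ Z') (α₂ : Z' ⟶ Y) (i : (towerR π).toD.obj Z' ≅ E),
      α₁ ≫ α₂ = α ∧ (towerR π).toD.map α₁ ≫ i.hom = δ ∧ i.inv ≫ (towerR π).toD.map α₂ = χ ∧
        PreFrobenioid.IsPullbackMorphism C0.toElem (R0.toC0.map α₁.fst) ∧
        PreFrobenioid.IsPullbackMorphism C0.toElem (R0.toC0.map α₂.fst) := by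
  obtain ⟨rZ, ZD, ιZ⟩ := Z
  obtain ⟨rY, YD, ιY⟩ := Y
  obtain ⟨g, aD, w⟩ := α
  change rZ ⟶ rY at g
  change ZD ⟶ YD at aD
  change ZD ⟶ E at δ
  change E ⟶ YD at χ
  change δ ≫ χ = aD at hfac
  change PreFrobenioid.IsPullbackMorphism C0.toElem g.left.hom.hom at hP
  have hgi : C0.div g.left.hom.hom = 1 := g.left.hom.property
  have w'' : R0.toD0.map g = (ιZ.hom ≫ π.map aD) ≫ ιY.inv := (Iso.eq_comp_inv ιY).mpr w
  have hb : (ιZ.hom ≫ π.map δ) ≫ (π.map χ ≫ ιY.inv) = C0.Base g.left.hom.hom :=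
    calc (ιZ.hom ≫ π.map δ) ≫ (π.map χ ≫ ιY.inv)
        = (ιZ.hom ≫ π.map (δ ≫ χ)) ≫ ιY.inv := by simp only [Functor.map_comp, Category.assoc]
      _ = (ιZ.hom ≫ π.map aD) ≫ ιY.inv := by rw [hfac]
      _ = R0.toD0.map g := w''.symm
  obtain ⟨Am, hA, b0, c0, hcomp, hbβ, hbα, hdβ, -, hdivβ, hdα, hsα, hisoα, hcar⟩ :=
    C0.exists_factor_pullRegion g.left.hom.hom (ιZ.hom ≫ π.map δ) (π.map χ ≫ ιY.inv) hb
  obtain ⟨hd_g, hfull⟩ := (C0.isPullbackMorphism_iff g.left.hom.hom).1 hP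
  have hcar' : (C0.mk (π.obj E) Am hA).region.carrier = C0.pullRegion _ (C0.Base c0) := by
    rw [hbα]; exact hcar
  have hpb₂ : PreFrobenioid.IsPullbackMorphism C0.toElem c0 :=
    C0.isPullbackMorphism_of_region_eq c0 hdα hsα hcar'
  have hpb₁ : PreFrobenioid.IsPullbackMorphism C0.toElem b0 :=
    C0.isPullbackMorphism_left_of_region_eq b0 c0 (hdβ.trans hd_g) hdα hsα hcar'
      (by rw [hcomp]; exact hfull)
  let E0 : C0 := ⟨π.obj E, Am, hA⟩
  let nE : N0 := ⟨⟨E0⟩⟩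
  have hisoβ : PreFrobenioid.IsIsometry C0.toElem b0 := by
    change C0.div b0 = 1
    rw [hdivβ, hgi]
  let gβ : rZ.left ⟶ nE := N0.homMk b0 hisoβ (hdβ.trans hd_g)
  let gα : nE ⟶ rY.left := N0.homMk c0 hisoα hdα
  have hβα : gβ ≫ gα = g.left := N0.hom_ext hcomp
  let rE : R0 := Over.mk (gα ≫ rY.hom)
  let αO : rE ⟶ rY := Over.homMk gα rfl
  have hwβ : gβ ≫ rE.hom = rZ.hom := by
    show gβ ≫ (gα ≫ rY.hom) = rZ.hom
    rw [← Category.assoc, hβα]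
    exact Over.w g
  let βO : rZ ⟶ rE := Over.homMk gβ hwβ
  let E' : (towerR π).F := ⟨rE, E, Iso.refl _⟩
  have hbβ' : R0.toD0.map βO = ιZ.hom ≫ π.map δ := hbβ
  have hbα' : R0.toD0.map αO = π.map χ ≫ ιY.inv := hbα
  have wβ : R0.toD0.map βO ≫ E'.iso.hom = ιZ.hom ≫ π.map δ := (Category.comp_id _).trans hbβ'
  have wα : R0.toD0.map αO ≫ ιY.hom = E'.iso.hom ≫ π.map χ :=
    ((Iso.eq_comp_inv ιY).mp hbα').trans (Category.id_comp _).symm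
  refine ⟨E', ⟨βO, δ, wβ⟩, ⟨αO, χ, wα⟩, Iso.refl E, CFP.hom_ext (Over.OverMorphism.ext hβα) hfac,
    Category.comp_id _, Category.id_comp _, hpb₁, hpb₂⟩

end ArchFrd

end

end Literature.AlgebraicGeometry.Frobenioids
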